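import Summits.ResolutionOfSingularities.ResolutionOfSingularities.Theorems.EquisingularLiftEquisingularLiftNatEmbeddedInfinitesimalLift
import Summits.ResolutionOfSingularities.ResolutionOfSingularities.Theorems.EquisingularLiftEquisingularLiftNatEmbeddedLiftTwist
import Summits.ResolutionOfSingularities.ResolutionOfSingularities.Theorems.EquisingularLiftEquisingularLiftNatEmbeddedLiftTwistPoint
import Summits.ResolutionOfSingularities.ResolutionOfSingularities.Theorems.EquisingularLiftEquisingularLiftNatLiftOfIdealSheafData
import Literature.AlgebraicGeometry.HodgeTheory.NormalSheafAffineSections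
import HarnessLib

/-!
# [OURS · L1 W4.5(b) · EL♮(3) · WIDTH TABLE D8 «NODAL HOSTED ROUND (HR-KEEP-N)», support debt S-D8-LIFT, part 4 (C6a)] THE CHOICE OF THE FIRST-ORDER
# LIFT: a flat lift of `Y₀` over `O/𝔪²` that is NOT inside `𝔪²` at any of finitely many prescribed points

res-L1-w45b-stub-4 g14 (desk R69 (iii) / DESK WORD g25-19; split of record STATUS 2026-08-29T04:20:51Z, brick (C6a)).  OURS; NOT a statement of any
manuscript ([Hironaka2017] is a candidate under adjudication, nothing of it is asserted); AI-written, weaker than expert review.  No `sorry`; standard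
axioms; DEF-FREE.  `--supports stmt-ResolutionOfSingularities-20148 --as helper`.

WHAT.  ★ `exists_firstOrder_lift_not_le_sq` — over a DVR `O` with residue surjection `θ : O ↠ k` onto an INFINITE field, a flat `w : W → Spec O`
locally of finite type with model square `(jW, tW)`, a closed `ι : Y₀ ↪ W₀` locally cut out by weakly regular sequences with `Ȟ¹(𝒩) = 0` on a two-piece
affine cover (J1's hypotheses verbatim), a GLOBAL normal section `ψ ∈ Γ(Y₀, 𝒩)`, and a FINITE set `T ⊆ Y₀` at each point of which `ψ` takes a unit
value on some section of the ideal (the (N4) clause) and the uniformiser is not in `𝔪²` of `W₁` (the first infinitesimal neighbourhood): THEN there is a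
flat first-order lift `G'` of `Y₀` (an ideal sheaf on `W₁` with `G'.comap t₀ = (ι ≫ e₀).ker`, `V(G') → Spec O/𝔪²` flat) whose stalk ideal at every
point of `T` is NOT inside `𝔪²`.
PROOF.  J1 ✓ `embeddedInfinitesimalLiftFact_holds` at `n = 0` gives SOME flat lift `G₀` (as the kernel of the produced closed immersion); the global
twist ✓ `exists_idealSheafData_twist` (p696354) by `c·ψ`, `c ∈ k` (scalars through `k → Γ(Y₀, ⊤)`), gives lifts `G_c`; at a point `z ∈ T` with its lci
chart `U_z` (inside the (N4) chart by `complOpens`) two twists `G_c, G_{c'}`, `c ≠ c'`, have difference section `(c' − c)·ψ|`, a unit value at `z`, so by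
✓ `not_le_sq_and_le_sq_of_isDiffSec` (p697163) AT MOST ONE `c` is bad at `z`; `T` finite and `k` infinite leave a good `c`.
[cite: Hartshorne2010, Thm. 6.2 (a)/(b)] [folklore; composition of the cited tree bricks]
-/

set_option linter.dupNamespace false -- mandated namespace `Summit.<Summit>.<Problem>` of this single-conjunct summit
-- `TopCat.Presheaf`/`Scheme.Modules` are not reducible (as in Mathlib's `AlgebraicGeometry/Modules` and the tree's `Modules/*`).
set_option backward.isDefEq.respectTransparency false

noncomputable section

open CategoryTheory CategoryTheory.Limits AlgebraicGeometry Opposite TopologicalSpace IsLocalRing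
open Literature.AlgebraicGeometry.Morphisms Literature.AlgebraicGeometry.Modules Literature.AlgebraicGeometry.Deformation
open Literature.AlgebraicGeometry.HodgeTheory

namespace Summit.ResolutionOfSingularities.ResolutionOfSingularities.Cruxes.EquisingularLiftNat.Sections

/-! ## Values of normal sections: the (N4) spelling is the engine's `appLE` spelling -/

/-- The (N4) value `normalSectionsVal i U ψ m` IS the engine's `appLE ψ (𝟙 _) (η m)` (both unfold to the evaluation of the morphism `ψ` on the pulled-back
section of `m`). [folklore; `rfl` up to the tree's unfolding lemmas] -/
theorem normalSectionsVal_eq_appLE {X Z : Scheme.{0}} (i : Z ⟶ X) (U : X.affineOpens)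
    (ψ : (conormalSheaf i).over (i ⁻¹ᵁ (U : X.Opens)) ⟶ (unitModule Z).over (i ⁻¹ᵁ (U : X.Opens))) (m : Γ(idealModule i, (U : X.Opens))) :
    normalSectionsVal i U ψ m = appLE ψ (𝟙 _) (unitSectionLE i (idealModule i) (le_refl (i ⁻¹ᵁ (U : X.Opens))) m) := by
  rw [normalSectionsVal_def, evalHom_apply, conormalSection_apply]

/-! ## The choice of the first-order lift -/

/-- ★ **THE FIRST-ORDER LIFT NOT INSIDE `𝔪²` AT FINITELY MANY PRESCRIBED POINTS.**  See the module docstring for the statement and the proof.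
[cite: Hartshorne2010, Thm. 6.2 (a)/(b)] [OURS · L1 W4.5b · WIDTH TABLE D8, support debt S-D8-LIFT, brick (C6a)] -/
theorem exists_firstOrder_lift_not_le_sq {O : Type} [CommRing O] [IsDomain O] [IsDiscreteValuationRing O] {k : Type} [Field k] [Infinite k]
    {θ : O →+* k} (hθ : Function.Surjective θ) {ϖ : O} (hϖ : Irreducible ϖ)
    {W : Scheme.{0}} {w : W ⟶ Spec (.of O)} [Flat w] [LocallyOfFiniteType w] {W₀ : Scheme.{0}} {jW : W₀ ⟶ W} {tW : W₀ ⟶ Spec (.of k)}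
    (hsq : IsPullback jW tW w (Spec.map (CommRingCat.ofHom θ)))
    (hI : maximalIdeal O ≤ RingHom.ker θ)
    {Y₀ : Scheme.{0}} (ι : Y₀ ⟶ W₀) [IsClosedImmersion ι]
    (hlci : ∀ z : Y₀, ∃ U : W₀.affineOpens, ι.base z ∈ (U : W₀.Opens) ∧
      ∃ rs : List Γ(W₀, U), RingTheory.Sequence.IsWeaklyRegular Γ(W₀, U) rs ∧ Ideal.ofList rs = ι.ker.ideal U)
    (hH1 : ∃ V : Fin 2 → Y₀.Opens, (∀ j, IsAffineOpen (V j)) ∧ IsAffineOpen (V 0 ⊓ V 1) ∧ ⨆ j, V j = ⊤ ∧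
      Subsingleton (CechMH1 Y₀.toSpecΓ (normalSheaf ι) V))
    -- the flat lift at level `n` to be extended
    (n : ℕ) {Yn : Scheme.{0}} (jn : Yn ⟶ infinitesimalNeighbourhood (maximalIdeal O) w n) [IsClosedImmersion jn]
    [Flat (jn ≫ infinitesimalNeighbourhood.toSpec (maximalIdeal O) w n)] {s₀ : Y₀ ⟶ Yn}
    (hs₀ : IsPullback s₀ ι (jn ≫ infinitesimalNeighbourhood.ι (maximalIdeal O) w n) jW)
    -- the (N4) section, the bad points, the uniformiser off `𝔪²` there
    (ψ : Γ(normalSheaf ι, ⊤)) (T : Set Y₀) (hT : T.Finite)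
    (hψ : ∀ z ∈ T, ∃ (U : W₀.affineOpens) (hz : z ∈ ι ⁻¹ᵁ (U : W₀.Opens)) (m : Γ(idealModule ι, (U : W₀.Opens))),
      IsUnit (Y₀.presheaf.germ (ι ⁻¹ᵁ (U : W₀.Opens)) z hz
        (normalSectionsVal ι U (normalSheafSectionsEquiv ι _ ((normalSheaf ι).presheaf.map (homOfLE le_top).op ψ)) m)))
    (hε : ∀ z ∈ T, ((infinitesimalNeighbourhood (maximalIdeal O) w (n + 1)).presheaf.Γgerm
        ((infinitesimalNeighbourhood.transition (maximalIdeal O) w n).base ((fibreEmb (maximalIdeal O) w θ hI hsq n).base (ι.base z)))).hom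
        (((infinitesimalNeighbourhood.toSpec (maximalIdeal O) w (n + 1)).appTop).hom
          ((Scheme.ΓSpecIso (.of (O ⧸ maximalIdeal O ^ (n + 1 + 1)))).inv.hom (Ideal.Quotient.mk _ (ϖ ^ (n + 1))))) ∉
      maximalIdeal ((infinitesimalNeighbourhood (maximalIdeal O) w (n + 1)).presheaf.stalk
        ((infinitesimalNeighbourhood.transition (maximalIdeal O) w n).base ((fibreEmb (maximalIdeal O) w θ hI hsq n).base (ι.base z)))) ^ 2) :
    ∃ G' : (infinitesimalNeighbourhood (maximalIdeal O) w (n + 1)).IdealSheafData,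
      G'.comap (infinitesimalNeighbourhood.transition (maximalIdeal O) w n) = jn.ker ∧
      Flat (G'.subschemeι ≫ infinitesimalNeighbourhood.toSpec (maximalIdeal O) w (n + 1)) ∧
      ∀ z ∈ T, ¬ Literature.AlgebraicGeometry.Resolution.stalkIdeal G'
          ((infinitesimalNeighbourhood.transition (maximalIdeal O) w n).base ((fibreEmb (maximalIdeal O) w θ hI hsq n).base (ι.base z))) ≤
        maximalIdeal _ ^ 2 := by
  classical
  -- the base data of the engine at `n = 0`: `𝔪 = ker θ`, `ε = ϖ`, `ann ε = 𝔪`, `𝔪` nilpotent in `O/𝔪²`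
  have hker : RingHom.ker θ = maximalIdeal O := ker_eq_maximalIdeal_of_surjective θ hθ
  have hI' : RingHom.ker θ ≤ maximalIdeal O := hker.le
  have hkert : RingHom.ker (infinitesimalNeighbourhood.transitionRingHom (maximalIdeal O) n) =
      Ideal.span {Ideal.Quotient.mk (maximalIdeal O ^ (n + 1 + 1)) (ϖ ^ (n + 1))} :=
    (Levels.ker_factor_eq_map_pow (O := O) (n + 1)).trans (Levels.map_pow_eq_span_mk_pow hϖ (n + 1))
  have hann : ∀ c : O ⧸ maximalIdeal O ^ (n + 1 + 1), Ideal.Quotient.mk (maximalIdeal O ^ (n + 1 + 1)) (ϖ ^ (n + 1)) * c = 0 ↔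
      c ∈ (RingHom.ker θ).map (Ideal.Quotient.mk (maximalIdeal O ^ (n + 1 + 1))) := fun c => by
    rw [hker]; exact Levels.mk_pow_mul_eq_zero_iff hϖ (n + 1) c
  have hεm : Ideal.Quotient.mk (maximalIdeal O ^ (n + 1 + 1)) (ϖ ^ (n + 1)) ∈ (RingHom.ker θ).map (Ideal.Quotient.mk (maximalIdeal O ^ (n + 1 + 1))) := by
    rw [hker]; exact Levels.mk_pow_succ_mem_map hϖ (n + 1) n
  have hnil : IsNilpotent ((RingHom.ker θ).map (Ideal.Quotient.mk (maximalIdeal O ^ (n + 1 + 1)))) := by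
    rw [hker]; exact Levels.isNilpotent_map_maximalIdeal (n + 1)
  -- `W₀` is locally Noetherian
  haveI : LocallyOfFiniteType tW := MorphismProperty.of_isPullback hsq inferInstance
  haveI : IsLocallyNoetherian W₀ := LocallyOfFiniteType.isLocallyNoetherian tW
  -- the fibre embeddings `e₀ : W₀ → W_0`, `e₁ = e₀ ≫ t₀ : W₀ → W_1`
  haveI hfE : IsClosedImmersion (fibreEmb (maximalIdeal O) w θ hI hsq n) := isClosedImmersion_fibreEmb _ w θ hI hsq hθ n
  haveI hfE' : IsClosedImmersion (fibreEmb (maximalIdeal O) w θ hI hsq (n + 1)) := isClosedImmersion_fibreEmb _ w θ hI hsq hθ (n + 1)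
  haveI ht : IsClosedImmersion (infinitesimalNeighbourhood.transition (maximalIdeal O) w n) := isClosedImmersion_transition _ w n
  haveI : Surjective (fibreEmb (maximalIdeal O) w θ hI hsq (n + 1)) := surjective_fibreEmb _ w θ hI hsq hθ hI' (n + 1)
  have hpre : ∀ U : (infinitesimalNeighbourhood (maximalIdeal O) w (n + 1)).Opens,
      fibreEmb (maximalIdeal O) w θ hI hsq n ⁻¹ᵁ ((infinitesimalNeighbourhood.transition (maximalIdeal O) w n) ⁻¹ᵁ U) =
        fibreEmb (maximalIdeal O) w θ hI hsq (n + 1) ⁻¹ᵁ U := fun U => by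
    rw [← Scheme.Hom.comp_preimage, fibreEmb_transition]
  have hpt : ∀ x₀ : W₀, (infinitesimalNeighbourhood.transition (maximalIdeal O) w n).base ((fibreEmb (maximalIdeal O) w θ hI hsq n).base x₀) =
      (fibreEmb (maximalIdeal O) w θ hI hsq (n + 1)).base x₀ := fun x₀ => by
    rw [← Scheme.Hom.comp_apply, fibreEmb_transition]
  -- STEP 1: some flat first-order lift `G₀` (J1 at `n = 0`)
  obtain ⟨Y₁, j₁, s, hj₁, hj₁flat, hsq₁⟩ := embeddedInfinitesimalLiftFact_holds O k θ hθ W w W₀ jW tW hsq inferInstance inferInstance Y₀ ι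
    inferInstance hlci hH1 n Yn jn inferInstance inferInstance ⟨s₀, hs₀⟩
  haveI := hj₁
  set G₀ : (infinitesimalNeighbourhood (maximalIdeal O) w (n + 1)).IdealSheafData := j₁.ker with hG₀def
  have hG₀ : G₀.comap (infinitesimalNeighbourhood.transition (maximalIdeal O) w n) = jn.ker := ker_comap_eq_of_isPullback hsq₁
  have hG₀flat : Flat (G₀.subschemeι ≫ infinitesimalNeighbourhood.toSpec (maximalIdeal O) w (n + 1)) := by
    have h1 : Flat (j₁.toImage ≫ j₁.ker.subschemeι ≫ infinitesimalNeighbourhood.toSpec (maximalIdeal O) w (n + 1)) := by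
      rw [← Category.assoc]
      change Flat ((j₁.toImage ≫ j₁.imageι) ≫ _)
      rw [j₁.toImage_imageι]; exact hj₁flat
    exact (MorphismProperty.cancel_left_of_respectsIso @Flat j₁.toImage _).mp h1
  -- lci traces on small affine charts around every point of `W_1`
  have hcharts : ∀ x : infinitesimalNeighbourhood (maximalIdeal O) w (n + 1),
      ∃ U : (infinitesimalNeighbourhood (maximalIdeal O) w (n + 1)).affineOpens,
        x ∈ (U : (infinitesimalNeighbourhood (maximalIdeal O) w (n + 1)).Opens) ∧ HasLciTrace (maximalIdeal O) w n θ hθ hI hsq ι U := by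
    intro x
    obtain ⟨x₀, rfl⟩ := (fibreEmb (maximalIdeal O) w θ hI hsq (n + 1)).surjective x
    by_cases hx₀ : x₀ ∈ Set.range ι.base
    · obtain ⟨z, rfl⟩ := hx₀
      obtain ⟨Uz, hzU, hUz⟩ := hlci z
      have hxN := base_mem_complOpens (fibreEmb (maximalIdeal O) w θ hI hsq (n + 1)) hzU
      obtain ⟨U, hU, hxU, hUN⟩ := exists_isAffineOpen_mem_and_subset hxN
      refine ⟨⟨U, hU⟩, hxU, ?_⟩
      have hle : (traceChart (maximalIdeal O) w n θ hθ hI hsq ⟨U, hU⟩ : W₀.Opens) ≤ Uz := by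
        rw [coe_traceChart, hpre, ← preimage_complOpens (fibreEmb (maximalIdeal O) w θ hI hsq (n + 1)) Uz]
        exact (fibreEmb (maximalIdeal O) w θ hI hsq (n + 1)).preimage_mono hUN
      exact exists_fin_of_list (exists_isWeaklyRegular_generators_of_le ι.ker (U := traceChart (maximalIdeal O) w n θ hθ hI hsq ⟨U, hU⟩) hle hUz)
    · set e := ι ≫ fibreEmb (maximalIdeal O) w θ hI hsq (n + 1) with he
      have hx : (fibreEmb (maximalIdeal O) w θ hI hsq (n + 1)).base x₀ ∉ Set.range e.base := by
        rintro ⟨y, hy⟩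
        rw [he, Scheme.Hom.comp_apply] at hy
        exact hx₀ ⟨y, (fibreEmb (maximalIdeal O) w θ hI hsq (n + 1)).isClosedEmbedding.injective hy⟩
      haveI : IsClosedImmersion e := by rw [he]; infer_instance
      have hxN := mem_complOpens_of_not_mem_range e ⊥ hx
      obtain ⟨U, hU, hxU, hUN⟩ := exists_isAffineOpen_mem_and_subset hxN
      have hempty : ∀ y : Y₀, e.base y ∉ U := fun y hy => by
        have h := hUN hy
        rw [SetLike.mem_coe, mem_complOpens_iff] at h
        exact h ⟨y, fun h' => h', rfl⟩
      have htrace : ι ⁻¹ᵁ (traceChart (maximalIdeal O) w n θ hθ hI hsq ⟨U, hU⟩ : W₀.Opens) = ⊥ := by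
        refine le_bot_iff.mp fun y hy => hempty y ?_
        rw [he, Scheme.Hom.comp_apply, ← hpt]
        exact hy
      refine ⟨⟨U, hU⟩, hxU, ?_⟩
      haveI := subsingleton_sections_of_eq_bot htrace
      refine exists_fin_of_eq_top ?_
      rw [Scheme.Hom.ker_apply]
      exact ker_eq_top_of_subsingleton _
  -- STEP 2: the twists `G_c`, `c ∈ k`, by the global sections `c·ψ`
  let φk : k →+* Γ(Y₀, ⊤) := ((ι ≫ tW).appTop).hom.comp (Scheme.ΓSpecIso (.of k)).inv.hom
  let ψ' : (conormalSheaf ι).over ⊤ ⟶ (unitModule Y₀).over ⊤ := normalSheafSectionsEquiv ι ⊤ ψ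
  let ψc : k → Γ(normalSheaf ι, ⊤) := fun c => (normalSheafSectionsEquiv ι ⊤).symm (φk c • ψ')
  have hGcex := fun c : k => exists_idealSheafData_twist (hq := hθ) hs₀ hkert hann hεm hnil G₀ hG₀ hG₀flat hcharts (ψc c)
  choose Gc hGc hGcflat hGcdiff using hGcex
  -- STEP 3: at each `z ∈ T`, an lci chart `U_z ∋ e₁(ι z)` inside the (N4) chart, and AT MOST ONE bad `c`
  have hone : ∀ z ∈ T, ∃ c₀ : k, ∀ c : k, c ≠ c₀ →
      ¬ Literature.AlgebraicGeometry.Resolution.stalkIdeal (Gc c)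
          ((infinitesimalNeighbourhood.transition (maximalIdeal O) w n).base ((fibreEmb (maximalIdeal O) w θ hI hsq n).base (ι.base z))) ≤ maximalIdeal _ ^ 2 := by
    intro z hzT
    obtain ⟨U₀, hz₀, m₀, hunit⟩ := hψ z hzT
    -- the chart `U_z`
    set x : infinitesimalNeighbourhood (maximalIdeal O) w (n + 1) :=
      (infinitesimalNeighbourhood.transition (maximalIdeal O) w n).base ((fibreEmb (maximalIdeal O) w θ hI hsq n).base (ι.base z)) with hx
    obtain ⟨U', hxU', hl'⟩ := hcharts x
    have hxN : x ∈ complOpens (fibreEmb (maximalIdeal O) w θ hI hsq (n + 1)) (U₀ : W₀.Opens) := by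
      rw [hx, hpt]; exact base_mem_complOpens _ hz₀
    obtain ⟨U, hU, hxU, hUN⟩ := exists_isAffineOpen_mem_and_subset
      (show x ∈ ((U' : (infinitesimalNeighbourhood (maximalIdeal O) w (n + 1)).Opens) ⊓ complOpens (fibreEmb (maximalIdeal O) w θ hI hsq (n + 1)) (U₀ : W₀.Opens))
        from ⟨hxU', hxN⟩)
    have hUU' : (U : (infinitesimalNeighbourhood (maximalIdeal O) w (n + 1)).Opens) ≤ U' := fun y hy => (hUN hy).1
    have hl : HasLciTrace (maximalIdeal O) w n θ hθ hI hsq ι ⟨U, hU⟩ := hl'.mono (U := U') (U' := ⟨U, hU⟩) hUU'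
    have hle₀ : (traceChart (maximalIdeal O) w n θ hθ hI hsq ⟨U, hU⟩ : W₀.Opens) ≤ U₀ := by
      rw [coe_traceChart, hpre, ← preimage_complOpens (fibreEmb (maximalIdeal O) w θ hI hsq (n + 1)) (U₀ : W₀.Opens)]
      exact (fibreEmb (maximalIdeal O) w θ hI hsq (n + 1)).preimage_mono fun y hy => (hUN hy).2
    have hzU : z ∈ ι ⁻¹ᵁ (traceChart (maximalIdeal O) w n θ hθ hI hsq ⟨U, hU⟩ : W₀.Opens) := hxU
    -- the restricted section `m` of the ideal and the unit value of `ψ` on it at `z`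
    set m : Γ(idealModule ι, (traceChart (maximalIdeal O) w n θ hθ hI hsq ⟨U, hU⟩ : W₀.Opens)) :=
      (idealModule ι).presheaf.map (homOfLE hle₀).op m₀ with hm
    -- the restrictions of the twisting sections, unfolded
    have hresψ : ∀ c : k, MSections.res Y₀.toSpecΓ (normalSheaf ι)
        (le_top : ι ⁻¹ᵁ (traceChart (maximalIdeal O) w n θ hθ hI hsq ⟨U, hU⟩ : W₀.Opens) ≤ ⊤) (ψc c) =
        restrictHom (homOfLE le_top) (φk c • ψ') := fun c => rfl
    have hval : ∀ c c' : k,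
        appLE (restrictHom (homOfLE (ι.preimage_mono (le_refl (traceChart (maximalIdeal O) w n θ hθ hI hsq ⟨U, hU⟩ : W₀.Opens))))
            (-(MSections.res Y₀.toSpecΓ (normalSheaf ι) (le_top : ι ⁻¹ᵁ (traceChart (maximalIdeal O) w n θ hθ hI hsq ⟨U, hU⟩ : W₀.Opens) ≤ ⊤) (ψc c))) +
          restrictHom (homOfLE (ι.preimage_mono (le_refl (traceChart (maximalIdeal O) w n θ hθ hI hsq ⟨U, hU⟩ : W₀.Opens))))
            (MSections.res Y₀.toSpecΓ (normalSheaf ι) (le_top : ι ⁻¹ᵁ (traceChart (maximalIdeal O) w n θ hθ hI hsq ⟨U, hU⟩ : W₀.Opens) ≤ ⊤) (ψc c')))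
          (𝟙 _) (unitSectionLE ι (idealModule ι) (le_refl _) m) =
        Y₀.presheaf.map (homOfLE (le_top : ι ⁻¹ᵁ (traceChart (maximalIdeal O) w n θ hθ hI hsq ⟨U, hU⟩ : W₀.Opens) ≤ ⊤)).op (φk (c' - c)) •
          appLE ψ' (homOfLE le_top) (unitSectionLE ι (idealModule ι) (le_refl _) m) := by
      intro c c'
      have hrneg : ∀ {B C : Y₀.Opens} (i : B ⟶ C) (φ : (conormalSheaf ι).over C ⟶ (unitModule Y₀).over C),
          restrictHom i (-φ) = -restrictHom i φ := fun i φ =>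
        eq_neg_of_add_eq_zero_left (by rw [← restrictHom_add, neg_add_cancel, restrictHom_zero])
      have hk : (𝟙 (ι ⁻¹ᵁ (traceChart (maximalIdeal O) w n θ hθ hI hsq ⟨U, hU⟩ : W₀.Opens)) ≫
          homOfLE (ι.preimage_mono (le_refl (traceChart (maximalIdeal O) w n θ hθ hI hsq ⟨U, hU⟩ : W₀.Opens)))) ≫
            homOfLE (le_top : ι ⁻¹ᵁ (traceChart (maximalIdeal O) w n θ hθ hI hsq ⟨U, hU⟩ : W₀.Opens) ≤ ⊤) = homOfLE le_top :=
        Subsingleton.elim _ _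
      rw [hresψ, hresψ, hrneg, appLE_add, appLE_neg, appLE_restrictHom, appLE_restrictHom, appLE_restrictHom, appLE_restrictHom, hk,
        appLE_smul, appLE_smul, map_sub, map_sub, sub_smul]
      abel
    have hunit' : IsUnit (Y₀.presheaf.germ (ι ⁻¹ᵁ (traceChart (maximalIdeal O) w n θ hθ hI hsq ⟨U, hU⟩ : W₀.Opens)) z hzU
        (appLE ψ' (homOfLE le_top) (unitSectionLE ι (idealModule ι) (le_refl _) m))) := by
      -- the (N4) unit at the bigger chart `U₀`, restricted to the trace chart
      have e1 : appLE ψ' (homOfLE le_top) (unitSectionLE ι (idealModule ι) (le_refl _) m) =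
          normalSectionsVal ι (traceChart (maximalIdeal O) w n θ hθ hI hsq ⟨U, hU⟩)
            (restrictHom (homOfLE (preimage_le ι hle₀)) (restrictHom (homOfLE (le_top : ι ⁻¹ᵁ (U₀ : W₀.Opens) ≤ ⊤)) ψ')) m := by
        rw [normalSectionsVal_eq_appLE, appLE_restrictHom, appLE_restrictHom]
        exact appLE_congr_hom _ _ _ _
      have e2 := normalSectionsVal_restrictHom ι (U := U₀) (U' := traceChart (maximalIdeal O) w n θ hθ hI hsq ⟨U, hU⟩) hle₀
        (restrictHom (homOfLE (le_top : ι ⁻¹ᵁ (U₀ : W₀.Opens) ≤ ⊤)) ψ') m₀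
      have key : (Y₀.presheaf.germ (ι ⁻¹ᵁ (traceChart (maximalIdeal O) w n θ hθ hI hsq ⟨U, hU⟩ : W₀.Opens)) z hzU).hom
            (appLE ψ' (homOfLE le_top) (unitSectionLE ι (idealModule ι) (le_refl _) m)) =
          (Y₀.presheaf.germ (ι ⁻¹ᵁ (U₀ : W₀.Opens)) z hz₀).hom
            (normalSectionsVal ι U₀ (restrictHom (homOfLE (le_top : ι ⁻¹ᵁ (U₀ : W₀.Opens) ≤ ⊤)) ψ') m₀) := by
        rw [e1, hm]
        exact (congrArg (fun t => (Y₀.presheaf.germ (ι ⁻¹ᵁ (traceChart (maximalIdeal O) w n θ hθ hI hsq ⟨U, hU⟩ : W₀.Opens)) z hzU).hom t) e2).trans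
          (TopCat.Presheaf.germ_res_apply Y₀.presheaf (homOfLE (preimage_le ι hle₀)) z hzU _)
      rw [key]
      exact hunit
    -- at most one bad `c`
    by_cases hbad : ∃ c₀ : k, Literature.AlgebraicGeometry.Resolution.stalkIdeal (Gc c₀) x ≤ maximalIdeal _ ^ 2
    · obtain ⟨c₀, hc₀⟩ := hbad
      refine ⟨c₀, fun c hc hcbad => ?_⟩
      -- the two chart ideals on `U_z` and their difference section `(c − c₀)·ψ|`
      have hGcU := isChartLift_ideal_of_comap_eq_ker_of_flat (Gc c₀) (hGc c₀) (hGcflat c₀) ⟨U, hU⟩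
      have hGc'U := isChartLift_ideal_of_comap_eq_ker_of_flat (Gc c) (hGc c) (hGcflat c) ⟨U, hU⟩
      have hG₀U := isChartLift_ideal_of_comap_eq_ker_of_flat G₀ hG₀ hG₀flat ⟨U, hU⟩
      have s₁ := isDiffSec_neg_of_isChartLift (U := ⟨U, hU⟩) hkert hεm (hGcdiff c₀ ⟨U, hU⟩ hl)
      have s₂ := hGcdiff c ⟨U, hU⟩ hl
      have s₁' := isDiffSec_restrict_of_isChartLift (hq := hθ) (U := ⟨U, hU⟩) (U' := ⟨U, hU⟩) hs₀ hkert hann hεm le_rfl hl hGcU hG₀U s₁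
      have s₂' := isDiffSec_restrict_of_isChartLift (hq := hθ) (U := ⟨U, hU⟩) (U' := ⟨U, hU⟩) hs₀ hkert hann hεm le_rfl hl hG₀U hGc'U s₂
      rw [ideal_map_presheaf_map_refl, ideal_map_presheaf_map_refl] at s₁' s₂'
      have s₁₂ := isDiffSec_add_of_isChartLift (hq := hθ) (U := ⟨U, hU⟩) hs₀ hkert hann hεm hGcU hG₀U hGc'U s₁' s₂'
      -- the value `(c − c₀)·ψ(η m)` is a unit at `z`
      have hμunit : IsUnit (Y₀.presheaf.germ (ι ⁻¹ᵁ (traceChart (maximalIdeal O) w n θ hθ hI hsq ⟨U, hU⟩ : W₀.Opens)) z hzU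
          (appLE (restrictHom (homOfLE (ι.preimage_mono (le_refl (traceChart (maximalIdeal O) w n θ hθ hI hsq ⟨U, hU⟩ : W₀.Opens))))
              (-(MSections.res Y₀.toSpecΓ (normalSheaf ι) (le_top : ι ⁻¹ᵁ (traceChart (maximalIdeal O) w n θ hθ hI hsq ⟨U, hU⟩ : W₀.Opens) ≤ ⊤) (ψc c₀))) +
            restrictHom (homOfLE (ι.preimage_mono (le_refl (traceChart (maximalIdeal O) w n θ hθ hI hsq ⟨U, hU⟩ : W₀.Opens))))
              (MSections.res Y₀.toSpecΓ (normalSheaf ι) (le_top : ι ⁻¹ᵁ (traceChart (maximalIdeal O) w n θ hθ hI hsq ⟨U, hU⟩ : W₀.Opens) ≤ ⊤) (ψc c)))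
            (𝟙 _) (unitSectionLE ι (idealModule ι) (le_refl _) m))) := by
        rw [hval c₀ c]
        have hcu : IsUnit (φk (c - c₀)) := (IsUnit.mk0 _ (sub_ne_zero.mpr hc)).map φk
        have h1 := (hcu.map (Y₀.presheaf.map (homOfLE (le_top : ι ⁻¹ᵁ (traceChart (maximalIdeal O) w n θ hθ hI hsq ⟨U, hU⟩ : W₀.Opens) ≤ ⊤)).op).hom).map
          (Y₀.presheaf.germ (ι ⁻¹ᵁ (traceChart (maximalIdeal O) w n θ hθ hI hsq ⟨U, hU⟩ : W₀.Opens)) z hzU).hom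
        have h2 := h1.mul hunit'
        rw [← map_mul] at h2
        exact h2
      refine not_le_sq_and_le_sq_of_isDiffSec (hq := hθ) hs₀ hkert hGcU hGc'U s₁₂ hzU m hμunit ?_ ⟨?_, ?_⟩
      · -- `ε ∉ 𝔪²` at the point
        intro h
        apply hε z hzT
        have e1 := congrArg (fun φ : O ⧸ maximalIdeal O ^ (n + 1 + 1) →+* Γ(infinitesimalNeighbourhood (maximalIdeal O) w (n + 1), U) =>
          φ (Ideal.Quotient.mk (maximalIdeal O ^ (n + 1 + 1)) (ϖ ^ (n + 1)))) (algebraMap_chartAlg_eq_map_comp (maximalIdeal O) w (n + 1) ⟨U, hU⟩)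
        simp only [RingHom.comp_apply] at e1
        rw [e1, TopCat.Presheaf.germ_res_apply] at h
        exact h
      · -- `G_{c₀}` is bad at `x`
        rw [← Literature.AlgebraicGeometry.Resolution.stalkIdeal_eq_map_germ (Gc c₀) ⟨U, hU⟩]
        exact hc₀
      · rw [← Literature.AlgebraicGeometry.Resolution.stalkIdeal_eq_map_germ (Gc c) ⟨U, hU⟩]
        exact hcbad
    · push Not at hbad
      exact ⟨0, fun c _ => hbad c⟩
  -- STEP 4: a good `c`, off the finitely many bad values
  choose! c₀ hc₀ using hone
  obtain ⟨c, -, hc⟩ := Set.infinite_univ.exists_notMem_finite (hT.image c₀)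
  refine ⟨Gc c, hGc c, hGcflat c, fun z hz => hc₀ z hz c fun h => hc ⟨z, hz, h.symm⟩⟩

end Summit.ResolutionOfSingularities.ResolutionOfSingularities.Cruxes.EquisingularLiftNat.Sections

end
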